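import Literature.Computability.Complexity.ExtMonotoneCircuits
import Literature.Computability.Complexity.ExtMonotoneGRankSupport
import Literature.Computability.Complexity.MonotoneSwitching
import Literature.Computability.Complexity.CliqueTestGraphs
import Literature.Computability.Complexity.CliqueCounting
import Literature.Computability.Complexity.ExtMonotoneCliqueGate
import Mathlib

/-!
# Stub `stub_engine` of line `width-threshold-certificate-sparsity` (crux `CliqueExtLowerBound`, stmt-PneNP-10682)

ENGINE: Jukna 2012 Thm 9.17 along a circuit of arbitrary monotone gates, each passed by its sandwichability hypothesis; errors collected in two global bad sets (event currency).
-/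

set_option linter.dupNamespace false

open Literature.Computability.Complexity Filter Finset

namespace Summit.PneNP.PneNP.Theorems.CliqueExtLowerBound.WidthThreshold.Engine

open GateList

open Classical in
/-- **Approximators along a program of sandwichable monotone gates** (Jukna 2012, proof of
Thm 9.17, in event currency): along a well-formed program all of whose gates are monotone and
`(r,s)`-sandwichable on `(P,N)` with error `ε` (children drawn from at most `A` distinct pairs,
`card ι + #gates ≤ A`), every wire `w` receives a pair `(cnf, dnf)` of an `(s-1)`-CNF and an
`(r-1)`-DNF with `dnf ≤ cnf`, and there are global bad sets `EP`, `EN` of at most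
`#gates · ε · #P` resp. `#gates · ε · #N` elements such that the value of `w` is `≤ dnf` on
`P ∖ EP` and `≥ cnf` on `N ∖ EN`. [cite: Jukna2012, Thm. 9.17] -/
theorem exists_eventApproximators {ι : Type} [Fintype ι] [DecidableEq ι] {r s A : ℕ}
    (hr : 2 ≤ r) (hs : 2 ≤ s) (P N : Finset (ι → Bool)) {ε : ℝ} :
    ∀ gs : List (Gate ι), WF gs → Fintype.card ι + gs.length ≤ A →
      (∀ g ∈ gs, Monotone g.op) →
      (∀ g ∈ gs, ∀ (D C : Fin g.arity → Finset (Finset ι)),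
        #(univ.image fun j => (D j, C j)) ≤ A →
        (∀ j, ∀ R ∈ D j, #R ≤ r - 1) → (∀ j, ∀ S ∈ C j, #S ≤ s - 1) →
        (∀ j x, EvalDNF (D j) x → EvalCNF (C j) x) →
        ∃ dnf cnf : Finset (Finset ι), (∀ R ∈ dnf, #R ≤ r - 1) ∧ (∀ S ∈ cnf, #S ≤ s - 1) ∧
          (∀ x, EvalDNF dnf x → EvalCNF cnf x) ∧
          (#(P.filter fun x => g.op (fun j => decide (EvalDNF (D j) x)) = true ∧ ¬ EvalDNF dnf x) : ℝ)
              ≤ ε * #P ∧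
          (#(N.filter fun x => EvalCNF cnf x ∧ g.op (fun j => decide (EvalCNF (C j) x)) = false) : ℝ)
              ≤ ε * #N) →
      ∃ (ap : ι ⊕ ℕ → Finset (Finset ι) × Finset (Finset ι)) (EP EN : Finset (ι → Bool)),
        (#EP : ℝ) ≤ gs.length * ε * #P ∧ (#EN : ℝ) ≤ gs.length * ε * #N ∧
        ∀ w : ι ⊕ ℕ, OutOK gs.length w →
          (∀ S ∈ (ap w).1, #S ≤ s - 1) ∧ (∀ R ∈ (ap w).2, #R ≤ r - 1) ∧
          (∀ x, EvalDNF (ap w).2 x → EvalCNF (ap w).1 x) ∧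
          (∀ x ∈ P, x ∉ EP → wireOf x (vals gs x) w = true → EvalDNF (ap w).2 x) ∧
          (∀ x ∈ N, x ∉ EN → EvalCNF (ap w).1 x → wireOf x (vals gs x) w = true) := by
  intro gs
  induction gs using List.reverseRecOn with
  | nil =>
    intro _ _ _ _
    refine ⟨fun w => match w with
      | .inl i => ({{i}}, {{i}})
      | .inr _ => (∅, ∅), ∅, ∅, by simp, by simp, fun w hw => ?_⟩
    rcases w with i | m
    · refine ⟨fun S hS => ?_, fun R hR => ?_, fun x hx => ?_, fun x _ _ hx => ?_, fun x _ _ hx => ?_⟩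
      · rw [Finset.mem_singleton.1 hS, Finset.card_singleton]; omega
      · rw [Finset.mem_singleton.1 hR, Finset.card_singleton]; omega
      · exact (evalCNF_singleton_singleton i).2 ((evalDNF_singleton_singleton i).1 hx)
      · exact (evalDNF_singleton_singleton i).2 (by simpa using hx)
      · simpa using (evalCNF_singleton_singleton i).1 hx
    · exact absurd (hw m rfl) (by simp)
  | append_singleton gs g ih =>
    intro hwf hA hmono hsand
    have hlen : (gs ++ [g]).length = gs.length + 1 := by simp
    rw [hlen] at hA
    obtain ⟨ap, EP, EN, hEP, hEN, hinv⟩ := ih hwf.of_append_left (by omega)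
      (fun g hg => hmono g (List.mem_append_left _ hg))
      (fun g hg => hsand g (List.mem_append_left _ hg))
    have hgOK : GateOK gs.length g := hwf.gateOK_mid (post := [])
    have hgm : Monotone g.op := hmono g (by simp)
    -- the children of the new gate are old wires
    have hch : ∀ j, OutOK gs.length (g.args j) := fun j m hm => hgOK j m hm
    obtain ⟨D, hD⟩ : ∃ D : Fin g.arity → Finset (Finset ι), ∀ j, D j = (ap (g.args j)).2 :=
      ⟨_, fun _ => rfl⟩
    obtain ⟨C, hC⟩ : ∃ C : Fin g.arity → Finset (Finset ι), ∀ j, C j = (ap (g.args j)).1 :=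
      ⟨_, fun _ => rfl⟩
    -- at most `card ι + gs.length ≤ A` distinct pairs feed the new gate
    have hcardDC : #(univ.image fun j => (D j, C j)) ≤ A := by
      have hsub : (univ.image fun j => (D j, C j)) ⊆
          (univ : Finset ι).image (fun i => ((ap (.inl i)).2, (ap (.inl i)).1)) ∪
            (range gs.length).image (fun m => ((ap (.inr m)).2, (ap (.inr m)).1)) := by
        intro p hp
        simp only [Finset.mem_image, Finset.mem_univ, true_and] at hp
        obtain ⟨j, rfl⟩ := hp
        rw [Finset.mem_union, Finset.mem_image, Finset.mem_image, hD, hC]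
        rcases hja : g.args j with i | m
        · exact Or.inl ⟨i, Finset.mem_univ _, rfl⟩
        · exact Or.inr ⟨m, Finset.mem_range.2 (hgOK j m hja), rfl⟩
      calc #(univ.image fun j => (D j, C j))
          ≤ #((univ : Finset ι).image (fun i => ((ap (.inl i)).2, (ap (.inl i)).1)) ∪
              (range gs.length).image (fun m => ((ap (.inr m)).2, (ap (.inr m)).1))) :=
            Finset.card_le_card hsub
        _ ≤ #((univ : Finset ι).image (fun i => ((ap (.inl i)).2, (ap (.inl i)).1))) +
              #((range gs.length).image (fun m => ((ap (.inr m)).2, (ap (.inr m)).1))) :=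
            Finset.card_union_le _ _
        _ ≤ Fintype.card ι + gs.length :=
            Nat.add_le_add (Finset.card_image_le.trans (by simp))
              (Finset.card_image_le.trans (by simp))
        _ ≤ A := by omega
    obtain ⟨dnf, cnf, hwd, hwc, hdc, hE1, hE2⟩ := hsand g (by simp) D C hcardDC
      (fun j => by rw [hD]; exact (hinv _ (hch j)).2.1)
      (fun j => by rw [hC]; exact (hinv _ (hch j)).1)
      (fun j => by rw [hD, hC]; exact (hinv _ (hch j)).2.2.1)
    -- the value of the new gate
    have hnew : ∀ x, wireOf x (vals (gs ++ [g]) x) (.inr gs.length) =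
        g.op (fun a => wireOf x (vals gs x) (g.args a)) := fun x => by
      rw [wireOf_inr, show gs ++ [g] = gs ++ g :: [] from rfl, getD_vals_append_cons]
    refine ⟨fun w => if w = .inr gs.length then (cnf, dnf) else ap w,
      EP ∪ P.filter (fun x => g.op (fun j => decide (EvalDNF (D j) x)) = true ∧ ¬ EvalDNF dnf x),
      EN ∪ N.filter (fun x => EvalCNF cnf x ∧ g.op (fun j => decide (EvalCNF (C j) x)) = false),
      ?_, ?_, fun w hw => ?_⟩
    · calc (#(EP ∪ P.filter (fun x => g.op (fun j => decide (EvalDNF (D j) x)) = true ∧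
              ¬ EvalDNF dnf x)) : ℝ)
          ≤ #EP + #(P.filter (fun x => g.op (fun j => decide (EvalDNF (D j) x)) = true ∧
              ¬ EvalDNF dnf x)) := by exact_mod_cast Finset.card_union_le _ _
        _ ≤ gs.length * ε * #P + ε * #P := add_le_add hEP hE1
        _ = (gs ++ [g]).length * ε * #P := by rw [hlen]; push_cast; ring
    · calc (#(EN ∪ N.filter (fun x => EvalCNF cnf x ∧
              g.op (fun j => decide (EvalCNF (C j) x)) = false)) : ℝ)
          ≤ #EN + #(N.filter (fun x => EvalCNF cnf x ∧
              g.op (fun j => decide (EvalCNF (C j) x)) = false)) := by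
            exact_mod_cast Finset.card_union_le _ _
        _ ≤ gs.length * ε * #N + ε * #N := add_le_add hEN hE2
        _ = (gs ++ [g]).length * ε * #N := by rw [hlen]; push_cast; ring
    · by_cases hwn : w = .inr gs.length
      · subst hwn
        simp only [if_true]
        refine ⟨hwc, hwd, hdc, fun x hxP hxE hval => ?_, fun x hxN hxE hcnf => ?_⟩
        · rw [hnew] at hval
          rw [Finset.mem_union, not_or] at hxE
          have hle : (fun a => wireOf x (vals gs x) (g.args a)) ≤
              fun j => decide (EvalDNF (D j) x) := by
            intro j
            refine Bool.le_iff_imp.2 fun h => decide_eq_true ?_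
            rw [hD]
            exact (hinv _ (hch j)).2.2.2.1 x hxP hxE.1 h
          have h1 : g.op (fun j => decide (EvalDNF (D j) x)) = true :=
            Bool.le_iff_imp.1 (hgm hle) hval
          by_contra hnd
          exact hxE.2 (Finset.mem_filter.2 ⟨hxP, h1, hnd⟩)
        · rw [hnew]
          rw [Finset.mem_union, not_or] at hxE
          have h1 : g.op (fun j => decide (EvalCNF (C j) x)) = true := by
            by_contra hf
            exact hxE.2 (Finset.mem_filter.2 ⟨hxN, hcnf, eq_false_of_ne_true hf⟩)
          have hle : (fun j => decide (EvalCNF (C j) x)) ≤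
              fun a => wireOf x (vals gs x) (g.args a) := by
            intro j
            refine Bool.le_iff_imp.2 fun h => ?_
            have h' := of_decide_eq_true h
            rw [hC] at h'
            exact (hinv _ (hch j)).2.2.2.2 x hxN hxE.1 h'
          exact Bool.le_iff_imp.1 (hgm hle) h1
      · simp only [if_neg hwn]
        have hw' : OutOK gs.length w := fun m hm => by
          have h1 := hw m hm
          simp only [List.length_append, List.length_singleton] at h1
          have h2 : m ≠ gs.length := fun h => hwn (hm.trans (by rw [h]))
          omega
        obtain ⟨h1, h2, h3, h4, h5⟩ := hinv w hw'
        refine ⟨h1, h2, h3, fun x hxP hxE hval => ?_, fun x hxN hxE hcnf => ?_⟩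
        · rw [wireOf_vals_append gs [g] x w hw'] at hval
          exact h4 x hxP (fun h => hxE (Finset.mem_union_left _ h)) hval
        · rw [wireOf_vals_append gs [g] x w hw']
          exact h5 x hxN (fun h => hxE (Finset.mem_union_left _ h)) hcnf

open Classical in
/-- **Engine** (registered stub `stub_engine`). [cite: Jukna2012, Thm. 9.17] -/
theorem stub_engine :
    ∀ (ι : Type) [Fintype ι] [DecidableEq ι] (r s A : ℕ), 2 ≤ r → 2 ≤ s →
    ∀ (P N : Finset (ι → Bool)) (ε : ℝ), 0 ≤ ε → ∀ M : Circuit ι,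
      Fintype.card ι + M.size + 1 ≤ A → (∀ g ∈ M.gates, Monotone g.op) →
      (∀ g ∈ M.gates, ∀ (D C : Fin g.arity → Finset (Finset ι)),
        #(univ.image fun j => (D j, C j)) ≤ A →
        (∀ j, ∀ R ∈ D j, #R ≤ r - 1) → (∀ j, ∀ S ∈ C j, #S ≤ s - 1) →
        (∀ j x, EvalDNF (D j) x → EvalCNF (C j) x) →
        ∃ dnf cnf : Finset (Finset ι), (∀ R ∈ dnf, #R ≤ r - 1) ∧ (∀ S ∈ cnf, #S ≤ s - 1) ∧
          (∀ x, EvalDNF dnf x → EvalCNF cnf x) ∧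
          (#(P.filter fun x => g.op (fun j => decide (EvalDNF (D j) x)) = true ∧ ¬ EvalDNF dnf x) : ℝ)
              ≤ ε * #P ∧
          (#(N.filter fun x => EvalCNF cnf x ∧ g.op (fun j => decide (EvalCNF (C j) x)) = false) : ℝ)
              ≤ ε * #N) →
      ∀ f : (ι → Bool) → Bool, M.Computes f →
        (#(N.filter fun x => f x = false) : ℝ) ≤ M.size * ε * #N ∨
          ∃ q : Finset ι, #q ≤ s - 1 ∧
            (#(P.filter fun x => f x = true ∧ ∀ i ∈ q, x i = false) : ℝ) ≤ M.size * ε * #P := by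
  intro ι _ _ r s A hr hs P N ε _ M hA hmono hsand f hf
  have hA' : Fintype.card ι + M.gates.length ≤ A := by unfold Circuit.size at hA; omega
  obtain ⟨ap, EP, EN, hEP, hEN, hinv⟩ :=
    exists_eventApproximators hr hs P N M.gates (wf_gates M) hA' hmono hsand
  obtain ⟨h1, -, h3, h4, h5⟩ := hinv M.output M.wf_output
  have hval : ∀ x, f x = wireOf x (vals M.gates x) M.output := fun x => by
    rw [← hf x, circuit_eval]
  rcases ((ap M.output).1).eq_empty_or_nonempty with he | ⟨S, hS⟩
  · left
    have hsub : (N.filter fun x => f x = false) ⊆ EN := fun x hx => by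
      rw [Finset.mem_filter] at hx
      by_contra hxE
      have := h5 x hx.1 hxE (by rw [he]; exact evalCNF_empty)
      rw [← hval, hx.2] at this
      exact Bool.false_ne_true this
    calc (#(N.filter fun x => f x = false) : ℝ) ≤ #EN := by
          exact_mod_cast Finset.card_le_card hsub
      _ ≤ _ := hEN
  · right
    refine ⟨S, h1 S hS, ?_⟩
    have hsub : (P.filter fun x => f x = true ∧ ∀ i ∈ S, x i = false) ⊆ EP := fun x hx => by
      rw [Finset.mem_filter] at hx
      by_contra hxE
      have hd := h4 x hx.1 hxE (by rw [← hval]; exact hx.2.1)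
      obtain ⟨i, hi, hxi⟩ := h3 x hd S hS
      rw [hx.2.2 i hi] at hxi
      exact Bool.false_ne_true hxi
    calc (#(P.filter fun x => f x = true ∧ ∀ i ∈ S, x i = false) : ℝ) ≤ #EP := by
          exact_mod_cast Finset.card_le_card hsub
      _ ≤ _ := hEP

end Summit.PneNP.PneNP.Theorems.CliqueExtLowerBound.WidthThreshold.Engine
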